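import Summits.CriticalPhenomena.Ising3DConformalLimit.Theorems.LogPolarProxyProxyUniversalityIsotropy
import Summits.CriticalPhenomena.Ising3DConformalLimit.Theorems.MoebiusLimitExists.Negative.FreePermutations
import Literature.Geometry.Euclidean.AxisRotationsGenerate
import HarnessLib

/-!
# Crux `ProxyUniversality` (stmt-CriticalPhenomena-11288), line `registered` — ISOTROPY CONSEQUENCES II:
# the limit-free azimuthal invariance forced by LC_pin, and the upgrade to full `O(3)` invariance

Route `LogPolarProxy`, sub-problem `Ising3DConformalLimit`; skeleton `Cruxes/ProxyUniversality/Lines/birth.lean`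
(v4, one open stub LC_pin `stub_latticeComparison`; continuation lead c2). THEOREM-ONLY file, companion of
`…Isotropy.lean` (axial rotations `planeRot 0 θ`, exact invariance of the proxy under all multiples of the
mesh angle, `apply_planeRot_eq_of_proxyUniversality`).

* §4 `tendstoLocallyUniformlyOn_rescaledCorrelator_planeRot_sub` — for ANY lattice family `G` and
  renormalisation `ρ`: if the renormalised proxy correlators (some profile) and the rescaled correlators of
  `G` at mesh `δ_N = π/(N+1)` differ by `o(1)` locally uniformly off the axis, then
  `ρ(δ_N)ⁿ (G n ⌊planeRot 0 (-(m_N δ_N)) ∘ p / δ_N⌋ − G n ⌊p/δ_N⌋) → 0` locally uniformly off the axis for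
  every sequence of multiples `m_N` with `m_N δ_N` bounded (uniform convergence on compacts; the bounded
  family of rotations sweeps a compact into a compact). `asymptotic_azimuthal_invariance_of_latticeComparison`
  — the registered open stub LC_pin (`∃`-form, pinned gauge) therefore forces ASYMPTOTIC AZIMUTHAL INVARIANCE
  OF THE CRITICAL `ℤ³` CORRELATORS along the proxy meshes: a necessary condition that mentions no limit
  object at all (a target for the crux disprover; with the coordinate symmetries of `ℤ³`, asymptotic
  invariance under rotations about every lattice axis).
* §5 `isRotationInvariant_of_proxyUniversality` — **the crux forces full rotation invariance of every
  continuous limit**: under `ProxyUniversality`, every non-degenerate pointwise scaling limit of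
  `criticalCorr 3` that is normalised off `NonCoincident`, continuous on it and translation invariant (the
  shape of the route's `ExistsContinuousLimit`, without scale covariance) is `IsRotationInvariant` (all of
  `O(3)`): axial rotations at every configuration by a translation off the axis
  (`apply_planeRot_eq_of_proxyUniversality_of_isTranslationInvariant`), coordinate permutations from the
  lattice (`limit_coordPerm`), the second axis and the coordinate reflection by conjugation, generation by
  `Literature.Geometry.Euclidean.apply_comp_eq_of_axisRotations` (bookkeeping adapted from
  `ModularQuarterTurnAxial.axialRotationUpgrade_proof`). Hence the universality crux ALONE carries the
  isotropy of the `ℤ³` limit (the isotropy cruxes of the sibling routes are consequences of it, not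
  bypassed by it), and any theorem forbidding isotropy of one such limit refutes the crux.

References: R. C. Brower, G. T. Fleming, H. Neuberger, Phys. Lett. B 721 (2013) 299–305, pp. 4–6
[BrowerFlemingNeuberger2013]; S. Friedli, Y. Velenik, *Statistical Mechanics of Lattice Systems* (2017),
Exercise 3.14 (lattice symmetries of the Gibbs states) [FriedliVelenik2017]; P. Di Francesco, P. Mathieu,
D. Sénéchal, *Conformal Field Theory* (1997) §4.3.1 [FrancescoMathieuSenechal1997].
-/

noncomputable section

namespace Summit.CriticalPhenomena.Ising3DConformalLimit.Cruxes.ProxyUniversality.Birth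

open scoped BigOperators Topology
open Filter Set Function
open Literature.Probability.LatticeModels
open Literature.MathematicalPhysics.QuantumFieldTheory (planeRot planeRot_apply)
open Summit.CriticalPhenomena.Ising3DConformalLimit.Theses.LogPolarProxy (ProxyUniversality)

/-! ## §4 Limit-free: the lattice comparison forces asymptotic azimuthal invariance of the lattice side -/

/-- **LC for a fixed profile ⟹ asymptotic azimuthal invariance of the rescaled lattice correlators
(limit-free).** Let `G` be any lattice family, `ρ` any renormalisation, and suppose the renormalised
proxy correlators (profile `J`, amplitudes `A`) and the rescaled correlators of `G` at the mesh
`δ_N = π/(N+1)` differ by `o(1)` locally uniformly off the axis at order `n`. Then for every sequence of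
multiples `m_N : ℕ` with `m_N δ_N` bounded,
`ρ(δ_N)ⁿ (G n ⌊planeRot 0 (-(m_N δ_N)) ∘ p / δ_N⌋ − G n ⌊p / δ_N⌋) → 0` locally uniformly on `offAxis n`:
the proxy side is exactly invariant (`proxyCorr_planeRot_natMul`), and locally uniform convergence on the
open set `offAxis n` is uniform convergence on its compact subsets, which the bounded family of rotations
maps into compact subsets. No limit object and no property of `G` is used. [folklore] -/
theorem tendstoLocallyUniformlyOn_rescaledCorrelator_planeRot_sub {Jr Jt Jp : ℕ → ℕ → ℝ}
    {A : ℕ → ℝ → ℝ} {ρ : ℝ → ℝ} {G : LatticeCorrFamily 3} {n : ℕ}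
    (hconv : TendstoLocallyUniformlyOn
      (fun (N : ℕ) (p : Fin n → EuclideanSpace ℝ (Fin 3)) =>
        proxyCorr Jr Jt Jp A ρ N n p - rescaledCorrelator G ρ n (Real.pi / ((N : ℝ) + 1)) p)
      (fun _ => 0) atTop (offAxis n))
    (m : ℕ → ℕ) {B : ℝ} (hB : ∀ N, (m N : ℝ) * (Real.pi / ((N : ℝ) + 1)) ≤ B) :
    TendstoLocallyUniformlyOn
      (fun (N : ℕ) (p : Fin n → EuclideanSpace ℝ (Fin 3)) =>
        rescaledCorrelator G ρ n (Real.pi / ((N : ℝ) + 1))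
            (fun i => planeRot (d := 2) 0 (-((m N : ℝ) * (Real.pi / ((N : ℝ) + 1)))) (p i)) -
          rescaledCorrelator G ρ n (Real.pi / ((N : ℝ) + 1)) p)
      (fun _ => 0) atTop (offAxis n) := by
  rw [tendstoLocallyUniformlyOn_iff_forall_isCompact (isOpen_offAxis n)] at hconv ⊢
  intro K hK hKc
  -- the compact set swept by the bounded family of rotations
  set K' : Set (Fin n → EuclideanSpace ℝ (Fin 3)) :=
    (fun q : ℝ × (Fin n → EuclideanSpace ℝ (Fin 3)) => fun i => planeRot (d := 2) 0 (-q.1) (q.2 i)) ''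
      (Set.Icc 0 B ×ˢ K) with hK'
  have hK'c : IsCompact K' := (isCompact_Icc.prod hKc).image (continuous_planeRot_neg_comp n)
  have hK'sub : K' ⊆ offAxis n := by
    rintro _ ⟨⟨a, q⟩, ⟨-, hq⟩, rfl⟩
    exact planeRot_mem_offAxis _ (hK hq)
  have hmemK' : ∀ N, ∀ p ∈ K,
      (fun i => planeRot (d := 2) 0 (-((m N : ℝ) * (Real.pi / ((N : ℝ) + 1)))) (p i)) ∈ K' := by
    intro N p hp
    refine ⟨⟨(m N : ℝ) * (Real.pi / ((N : ℝ) + 1)), p⟩, ⟨⟨?_, hB N⟩, hp⟩, rfl⟩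
    exact mul_nonneg (Nat.cast_nonneg _) (div_pos Real.pi_pos (Nat.cast_add_one_pos _)).le
  have hU := hconv K hK hKc
  have hU' := hconv K' hK'sub hK'c
  rw [Metric.tendstoUniformlyOn_iff] at hU hU' ⊢
  intro ε hε
  filter_upwards [hU (ε / 2) (half_pos hε), hU' (ε / 2) (half_pos hε)] with N hN hN' p hp
  have h1 := hN p hp
  have h2 := hN' _ (hmemK' N p hp)
  rw [proxyCorr_planeRot_natMul Jr Jt Jp A ρ N n (m N) p (hK hp).2] at h2
  rw [dist_comm, Real.dist_0_eq_abs] at h1 h2 ⊢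
  calc |rescaledCorrelator G ρ n (Real.pi / ((N : ℝ) + 1))
            (fun i => planeRot (d := 2) 0 (-((m N : ℝ) * (Real.pi / ((N : ℝ) + 1)))) (p i)) -
          rescaledCorrelator G ρ n (Real.pi / ((N : ℝ) + 1)) p|
        = |(proxyCorr Jr Jt Jp A ρ N n p - rescaledCorrelator G ρ n (Real.pi / ((N : ℝ) + 1)) p) -
            (proxyCorr Jr Jt Jp A ρ N n p - rescaledCorrelator G ρ n (Real.pi / ((N : ℝ) + 1))
              (fun i => planeRot (d := 2) 0 (-((m N : ℝ) * (Real.pi / ((N : ℝ) + 1)))) (p i)))| := by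
          congr 1; ring
    _ ≤ |proxyCorr Jr Jt Jp A ρ N n p - rescaledCorrelator G ρ n (Real.pi / ((N : ℝ) + 1)) p| +
          |proxyCorr Jr Jt Jp A ρ N n p - rescaledCorrelator G ρ n (Real.pi / ((N : ℝ) + 1))
            (fun i => planeRot (d := 2) 0 (-((m N : ℝ) * (Real.pi / ((N : ℝ) + 1)))) (p i))| :=
          abs_sub _ _
    _ < ε / 2 + ε / 2 := add_lt_add h1 h2
    _ = ε := add_halves ε

/-- **LC_pin (the registered open stub, `∃`-form) ⟹ asymptotic azimuthal invariance of the critical `ℤ³`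
correlators in the pinned gauge — a LIMIT-FREE necessary condition for the stub.** If profiles and
amplitudes as in `stub_latticeComparison` exist, then for every even `n ≠ 0` and every sequence of
multiples `m_N` with `m_N δ_N` bounded (`δ_N = π/(N+1)`),
`ρ_pin(δ_N)ⁿ (⟨∏ᵢ σ_{⌊planeRot 0 (-(m_N δ_N)) pᵢ / δ_N⌋}⟩_{β_c} − ⟨∏ᵢ σ_{⌊pᵢ/δ_N⌋}⟩_{β_c}) → 0` locally
uniformly on injective off-axis configurations: the renormalised critical correlators of `ℤ³` become
invariant under the rotations about a lattice axis along the proxy meshes. Nothing here mentions a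
scaling limit. [cite: BrowerFlemingNeuberger2013, pp. 4–6] -/
theorem asymptotic_azimuthal_invariance_of_latticeComparison :
    (∃ (Jr Jt Jp : ℕ → ℕ → ℝ) (A : ℕ → ℝ → ℝ), (∀ N j, 0 ≤ Jr N j ∧ 0 ≤ Jt N j ∧ 0 ≤ Jp N j) ∧
      (∀ N θ, 0 < A N θ) ∧
      ∀ n : ℕ, Even n → n ≠ 0 →
        TendstoLocallyUniformlyOn
          (fun (N : ℕ) (p : Fin n → EuclideanSpace ℝ (Fin 3)) =>
            proxyCorr Jr Jt Jp A
                (fun δ : ℝ => (criticalTwoPoint 3 (Pi.single 0 (⌊1 / δ⌋ : ℤ))) ^ (-(1 / 2 : ℝ))) N n p -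
              rescaledCorrelator (criticalCorr 3)
                (fun δ : ℝ => (criticalTwoPoint 3 (Pi.single 0 (⌊1 / δ⌋ : ℤ))) ^ (-(1 / 2 : ℝ))) n
                (Real.pi / ((N : ℝ) + 1)) p)
          (fun _ => 0) atTop (offAxis n)) →
    ∀ n : ℕ, Even n → n ≠ 0 → ∀ (m : ℕ → ℕ) (B : ℝ),
      (∀ N, (m N : ℝ) * (Real.pi / ((N : ℝ) + 1)) ≤ B) →
      TendstoLocallyUniformlyOn
        (fun (N : ℕ) (p : Fin n → EuclideanSpace ℝ (Fin 3)) =>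
          rescaledCorrelator (criticalCorr 3)
              (fun δ : ℝ => (criticalTwoPoint 3 (Pi.single 0 (⌊1 / δ⌋ : ℤ))) ^ (-(1 / 2 : ℝ))) n
              (Real.pi / ((N : ℝ) + 1))
              (fun i => Literature.MathematicalPhysics.QuantumFieldTheory.planeRot (d := 2) 0
                (-((m N : ℝ) * (Real.pi / ((N : ℝ) + 1)))) (p i)) -
            rescaledCorrelator (criticalCorr 3)
              (fun δ : ℝ => (criticalTwoPoint 3 (Pi.single 0 (⌊1 / δ⌋ : ℤ))) ^ (-(1 / 2 : ℝ))) n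
              (Real.pi / ((N : ℝ) + 1)) p)
        (fun _ => 0) atTop (offAxis n) := by
  rintro ⟨Jr, Jt, Jp, A, -, -, hconv⟩ n hn hn0 m B hB
  exact tendstoLocallyUniformlyOn_rescaledCorrelator_planeRot_sub (hconv n hn hn0) m hB


/-! ## §5 Upgrade: with the symmetries of `ℤ³`, the crux forces full `O(3)` invariance of continuous limits -/

section Upgrade

open Summit.CriticalPhenomena.Ising3DConformalLimit.MoebiusLimitExistsNegative (coordPerm_apply
  limit_coordPerm map_mem_nonCoincident_iff)

/-- **Axial rotation invariance at EVERY configuration.** Under `ProxyUniversality`, a non-degenerate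
pointwise scaling limit `(ρ, S)` of `criticalCorr 3` which is normalised (`S = 0` off `NonCoincident`),
continuous on `NonCoincident` and translation invariant satisfies `S n (planeRot 0 θ ∘ x) = S n x` for all
`θ`, `n`, `x`: injective configurations are translated off the axis along `e₀` (translation invariance; the
rotation is linear), where `apply_planeRot_eq_of_proxyUniversality` applies, and both sides vanish at
non-injective ones. [cite: BrowerFlemingNeuberger2013, pp. 4–6] -/
theorem apply_planeRot_eq_of_proxyUniversality_of_isTranslationInvariant (h : ProxyUniversality)
    {ρ : ℝ → ℝ} {S : CorrFamily 3} (hρ : ∀ δ ∈ Set.Ioc (0:ℝ) 1, 0 < ρ δ)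
    (hlim : HasPointwiseScalingLimit (criticalCorr 3) ρ S) (hnd : IsNondegenerateTwoPoint S)
    (hnorm : ∀ n z, z ∉ NonCoincident 3 n → S n z = 0)
    (hcont : ∀ n, ContinuousOn (S n) (NonCoincident 3 n)) (htr : IsTranslationInvariant S)
    (θ : ℝ) (n : ℕ) (x : Fin n → EuclideanSpace ℝ (Fin 3)) :
    S n (fun i => planeRot (d := 2) 0 θ (x i)) = S n x := by
  by_cases hx : Function.Injective x
  · -- translate off the axis along `e₀`
    set t : ℝ := 1 + ∑ i, |x i 0| with ht
    set v : EuclideanSpace ℝ (Fin 3) := EuclideanSpace.single 0 t with hv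
    have hoff : (fun i => x i + v) ∈ offAxis n := by
      refine ⟨fun i j hij => hx (add_right_cancel hij), fun i => ?_⟩
      rintro ⟨h0, -⟩
      have e0 : (x i + v) 0 = x i 0 + t := by
        simp [hv]
      rw [e0] at h0
      have hle : |x i 0| ≤ ∑ j, |x j 0| :=
        Finset.single_le_sum (f := fun j => |x j 0|) (fun j _ => abs_nonneg _) (Finset.mem_univ i)
      have hna := neg_abs_le (x i 0)
      linarith
    have hcont' : ContinuousWithinAt (S n) (offAxis n)
        (fun i => planeRot (d := 2) 0 θ ((fun i => x i + v) i)) :=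
      ((hcont n).mono (offAxis_subset_nonCoincident n)).continuousWithinAt (planeRot_mem_offAxis θ hoff)
    have key := apply_planeRot_eq_of_proxyUniversality h ρ S hρ hlim hnd n θ _ hoff hcont'
    have e1 : (fun i => planeRot (d := 2) 0 θ ((fun i => x i + v) i)) =
        fun i => planeRot (d := 2) 0 θ (x i) + planeRot (d := 2) 0 θ v := by
      funext i
      exact map_add _ _ _
    rw [e1, htr n (planeRot (d := 2) 0 θ v) (fun i => planeRot (d := 2) 0 θ (x i)), htr n v x] at key
    exact key
  · have hx' : (fun i => planeRot (d := 2) 0 θ (x i)) ∉ NonCoincident 3 n := fun h' =>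
      hx ((map_mem_nonCoincident_iff _ x).1 h')
    rw [hnorm n _ hx', hnorm n x hx]

/-- **The crux forces full rotation invariance of every continuous limit.** If `ProxyUniversality` holds,
then every non-degenerate pointwise scaling limit `(ρ, S)` of the critical `ℤ³` correlators which is
normalised off `NonCoincident`, continuous on `NonCoincident` and translation invariant — the shape of the
route's existence crux `ExistsContinuousLimit`, WITHOUT its scale covariance — is `IsRotationInvariant`
(all of `O(3)`, all configurations): rotations about `e₃` by every angle from the proxy
(`apply_planeRot_eq_of_proxyUniversality_of_isTranslationInvariant`), coordinate permutations of `ℝ³` from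
the lattice (`limit_coordPerm`), hence rotations about `e₂` and the coordinate reflection by conjugation,
and two axes plus one reflection generate `O(3)` (`Literature.Geometry.Euclidean.apply_comp_eq_of_axisRotations`;
group bookkeeping adapted from `ModularQuarterTurnAxial.axialRotationUpgrade_proof`). So the universality
crux alone carries the isotropy of the `ℤ³` limit: the route's `MoebiusFromTranslationsAndInversion` is
needed only for bookkeeping, and any rigidity theorem forbidding isotropy of some such limit refutes the
crux. [cite: BrowerFlemingNeuberger2013, pp. 4–6] -/
theorem isRotationInvariant_of_proxyUniversality :
    ProxyUniversality → ∀ (ρ : ℝ → ℝ) (S : CorrFamily 3), (∀ δ ∈ Set.Ioc (0:ℝ) 1, 0 < ρ δ) →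
      HasPointwiseScalingLimit (criticalCorr 3) ρ S → IsNondegenerateTwoPoint S →
      (∀ n z, z ∉ NonCoincident 3 n → S n z = 0) → (∀ n, ContinuousOn (S n) (NonCoincident 3 n)) →
      IsTranslationInvariant S → IsRotationInvariant S := by
  intro h ρ S hρ hlim hnd hnorm hcont htr
  -- coordinate permutations of `ℝ³`, at every configuration (lattice symmetry, no continuity needed)
  have hP : ∀ (τ : Equiv.Perm (Fin 3)) (n : ℕ) (x : Fin n → EuclideanSpace ℝ (Fin 3)),
      S n (fun i => LinearIsometryEquiv.piLpCongrLeft 2 ℝ ℝ τ (x i)) = S n x := by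
    intro τ n x
    by_cases hx : x ∈ NonCoincident 3 n
    · exact limit_coordPerm hlim τ hx
    · have hx' : (fun i => LinearIsometryEquiv.piLpCongrLeft 2 ℝ ℝ τ (x i)) ∉ NonCoincident 3 n :=
        fun h' => hx ((map_mem_nonCoincident_iff _ x).1 h')
      rw [hnorm n _ hx', hnorm n _ hx]
  -- rotations about `e₃`, at every configuration (the proxy)
  have hRz : ∀ (φ : ℝ) (n : ℕ) (x : Fin n → EuclideanSpace ℝ (Fin 3)),
      S n (fun i => planeRot (d := 2) 0 φ (x i)) = S n x := fun φ n x =>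
    apply_planeRot_eq_of_proxyUniversality_of_isTranslationInvariant h hρ hlim hnd hnorm hcont htr φ n x
  intro n R x
  refine Literature.Geometry.Euclidean.apply_comp_eq_of_axisRotations (S n) ?_ ?_ ?_ R x
  · intro φ
    refine ⟨planeRot (d := 2) 0 φ, fun y => ?_, hRz φ n⟩
    ext j
    fin_cases j <;> simp [planeRot_apply]
  · intro φ
    refine ⟨planeRot (d := 2) 1 φ, fun y => ?_, fun z => ?_⟩
    · ext j
      fin_cases j <;> simp [planeRot_apply]
    · -- `planeRot 1 φ = (1 2) ∘ planeRot 0 φ ∘ (1 2)`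
      have e : (fun i => planeRot (d := 2) 1 φ (z i)) = fun i =>
          LinearIsometryEquiv.piLpCongrLeft 2 ℝ ℝ (Equiv.swap 1 2) (planeRot (d := 2) 0 φ
            (LinearIsometryEquiv.piLpCongrLeft 2 ℝ ℝ (Equiv.swap 1 2) (z i))) := by
        funext i
        ext j
        fin_cases j <;>
          simp [planeRot_apply, coordPerm_apply, Equiv.swap_apply_of_ne_of_ne, Equiv.symm_swap,
            Equiv.swap_apply_left, Equiv.swap_apply_right]
      rw [e, hP, hRz, hP]
  · intro z
    -- `(x₀,x₁,x₂) ↦ (-x₀,x₁,x₂)` is `(0 1) ∘ planeRot 0 (π/2)`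
    have e : (fun i => (WithLp.toLp 2 ![-(z i) 0, z i 1, z i 2] : EuclideanSpace ℝ (Fin 3))) = fun i =>
        LinearIsometryEquiv.piLpCongrLeft 2 ℝ ℝ (Equiv.swap 0 1)
          (planeRot (d := 2) 0 (Real.pi / 2) (z i)) := by
      funext i
      ext j
      fin_cases j <;>
        simp [planeRot_apply, coordPerm_apply, Equiv.swap_apply_of_ne_of_ne, Equiv.symm_swap,
          Equiv.swap_apply_left, Equiv.swap_apply_right]
    rw [e, hP, hRz]

end Upgrade

end Summit.CriticalPhenomena.Ising3DConformalLimit.Cruxes.ProxyUniversality.Birth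

end
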